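import Literature.Barriers.ABC.BakerMethodBoundsStewartYuProofs
import Literature.NumberTheory.DiophantineGeometry.AbcWave0QualityFormProofs

/-!
# Small-prime clearing in the hard core (stub `stub_smallPrimeClearing`)

Helper (`--supports`) for the crux `Summit.ABC.ABC.Theses.RibetTakahashiSplit.FewPrimeValuationProduct`
(stmt-ABC-1563), line `matveev-face-clearing`: the stub `stub_smallPrimeClearing` of the planner
skeleton, proved UNCONDITIONALLY as an implication from `∃ K ≥ 1, PastenApproximationBound K`
(Matveev + Yu over `ℚ` in Pasten's form, Pasten 2024, Thm 2.1; not assumed as a fact here).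

**Statement.** For every `ε > 0` there is `C = C(K, ε)` such that every abc triple on `≤ 4` primes,
none of whose members is a power of two, having an odd prime `ℓ₀ ∣ abc` with `ℓ₀ ≤ rad^ε`, satisfies
`∏_{p ∣ abc} v_p(abc) ≤ C · rad^{5ε}`.

**Proof.** *Shape* (`primeFactors_subset_pair`): the members are pairwise coprime, `2 ∣ abc`, and
each member has an odd prime; with `≤ 4` primes the member `w ∋ ℓ₀` has its primes in `{2, ℓ₀}`, so
`1 + 3 ∑_{p ∣ w} p ≤ 10 ℓ₀ ≤ 10 rad^ε`. *Route through `w`* (Stewart–Yu on the approximation bound,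
`Literature.Barriers.ABC.log_lt_route_a/_b/_c`): `log c < Θ · Y · (1 + 3 ∑_{p ∣ w} p)` with
`Y = log max{e, 2 log c}`, `Θ = K^{ω(uv)+1} ∏_{p ∣ uv} log p ≤ K⁵Λ⁴`, `Λ = max(log rad, 1)`.
*Self-improvement* (`le_of_le_mul_log_max`, `M = 10K⁵Λ⁴rad^ε`): `log c ≤ 20K⁵(log(40K⁵) + 4 + ε) rad^ε Λ⁵`.
*Product*: `v_p(abc) log 2 ≤ log(abc) ≤ 3 log c`, `≤ 4` factors, `Λ²⁰ ≤ D(ε) rad^ε`. The glue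
`polylog_le_rpow` / `prod_factorization_le` is adapted from the planner skeleton (private copies).

References: C. L. Stewart, K. Yu, Duke Math. J. 108 (2001), §3; H. Pasten, Invent. Math. 236 (2024),
Thm 2.1; J.-H. Evertse, K. Győry, *Unit Equations in Diophantine Number Theory* (2015), Thm 4.2.1.
-/

-- `Summit.ABC.ABC` is the mandated summit-side namespace (CONVENTIONS §2); the duplicate is deliberate.
set_option linter.dupNamespace false

noncomputable section

namespace Summit.ABC.ABC.Theorems.FewPrimeValuationProduct

open Finset Real
open Literature.NumberTheory.DiophantineGeometry
open Literature.NumberTheory.DiophantineGeometry.Dioph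
open Literature.NumberTheory.DiophantineGeometry.Pasten
open Literature.Barriers.ABC

/-! ## The shape of a non-face triple on `≤ 4` primes -/

/-- A non-zero natural number that is not a power of two has an odd prime factor. [folklore] -/
private theorem exists_odd_mem_primeFactors {n : ℕ} (hn : n ≠ 0) (h : ¬ ∃ j : ℕ, n = 2 ^ j) :
    ∃ p ∈ n.primeFactors, p ≠ 2 := by
  by_contra hall
  push Not at hall
  exact h ⟨_, Nat.eq_prime_pow_of_unique_prime_dvd hn fun hd hdn =>
    hall _ (Nat.mem_primeFactors.mpr ⟨hd, hdn, hn⟩)⟩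

/-- For an abc triple, `2 ∣ abc`: if `a` and `b` are odd then `c = a + b` is even. [folklore] -/
private theorem two_dvd_abc {a b c : ℕ} (h : IsABCTriple a b c) : 2 ∣ a * b * c := by
  obtain ⟨-, -, habc, -⟩ := h
  have h3 : a % 2 = 0 ∨ b % 2 = 0 ∨ c % 2 = 0 := by omega
  rcases h3 with h0 | h0 | h0
  · exact Dvd.dvd.mul_right (Dvd.dvd.mul_right (Nat.dvd_of_mod_eq_zero h0) _) _
  · exact Dvd.dvd.mul_right (Dvd.dvd.mul_left (Nat.dvd_of_mod_eq_zero h0) _) _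
  · exact Dvd.dvd.mul_left (Nat.dvd_of_mod_eq_zero h0) _

/-- **Shape of the hard core.** Let `u, v, w` be pairwise coprime and non-zero with `2 ∣ uvw` and
`ω(uvw) ≤ 4`, with `v` and `w` not powers of two. If `ℓ` is an odd prime factor of `u`, then every
prime factor of `u` lies in `{2, ℓ}` (the odd primes of `v`, `w` are two further distinct odd primes
and `2` is a fourth prime of `uvw`). [folklore] -/
private theorem primeFactors_subset_pair {u v w : ℕ} (hu : u ≠ 0) (hv : v ≠ 0) (hw : w ≠ 0)
    (huv : u.Coprime v) (huw : u.Coprime w) (hvw : v.Coprime w) (h2 : 2 ∣ u * v * w)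
    (hcard : (u * v * w).primeFactors.card ≤ 4)
    (hv2 : ¬ ∃ j : ℕ, v = 2 ^ j) (hw2 : ¬ ∃ j : ℕ, w = 2 ^ j)
    {ℓ : ℕ} (hℓ : ℓ ∈ u.primeFactors) (hℓ2 : ℓ ≠ 2) :
    u.primeFactors ⊆ {2, ℓ} := by
  obtain ⟨pv, hpv, hpv2⟩ := exists_odd_mem_primeFactors hv hv2
  obtain ⟨pw, hpw, hpw2⟩ := exists_odd_mem_primeFactors hw hw2
  have hS : (u * v * w).primeFactors = u.primeFactors ∪ v.primeFactors ∪ w.primeFactors := by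
    rw [Nat.primeFactors_mul (mul_ne_zero hu hv) hw, Nat.primeFactors_mul hu hv]
  have h2mem : 2 ∈ (u * v * w).primeFactors :=
    Nat.mem_primeFactors.mpr ⟨Nat.prime_two, h2, mul_ne_zero (mul_ne_zero hu hv) hw⟩
  -- the odd primes of `uvw`: at most three, split among `u`, `v`, `w`
  have hO : ((u * v * w).primeFactors.erase 2).card ≤ 3 := by
    rw [Finset.card_erase_of_mem h2mem]; omega
  have hdisj₁ : Disjoint (u.primeFactors.erase 2) (v.primeFactors.erase 2) :=
    Disjoint.mono (Finset.erase_subset _ _) (Finset.erase_subset _ _) huv.disjoint_primeFactors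
  have hdisj₂ : Disjoint (u.primeFactors.erase 2 ∪ v.primeFactors.erase 2) (w.primeFactors.erase 2) :=
    Finset.disjoint_union_left.mpr
      ⟨Disjoint.mono (Finset.erase_subset _ _) (Finset.erase_subset _ _) huw.disjoint_primeFactors,
        Disjoint.mono (Finset.erase_subset _ _) (Finset.erase_subset _ _) hvw.disjoint_primeFactors⟩
  have hsum : (u.primeFactors.erase 2).card + (v.primeFactors.erase 2).card +
      (w.primeFactors.erase 2).card ≤ 3 := by
    rw [← Finset.card_union_of_disjoint hdisj₁, ← Finset.card_union_of_disjoint hdisj₂,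
      ← Finset.erase_union_distrib, ← Finset.erase_union_distrib, ← hS]
    exact hO
  have hv1 : 0 < (v.primeFactors.erase 2).card :=
    Finset.card_pos.mpr ⟨pv, Finset.mem_erase.mpr ⟨hpv2, hpv⟩⟩
  have hw1 : 0 < (w.primeFactors.erase 2).card :=
    Finset.card_pos.mpr ⟨pw, Finset.mem_erase.mpr ⟨hpw2, hpw⟩⟩
  have hu1 : (u.primeFactors.erase 2).card ≤ 1 := by omega
  have hℓO : ℓ ∈ u.primeFactors.erase 2 := Finset.mem_erase.mpr ⟨hℓ2, hℓ⟩
  intro q hq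
  rw [Finset.mem_insert, Finset.mem_singleton]
  by_cases hq2 : q = 2
  · exact Or.inl hq2
  · exact Or.inr (Finset.card_le_one.mp hu1 q (Finset.mem_erase.mpr ⟨hq2, hq⟩) ℓ hℓO)

/-- If the primes of `w` lie in `{2, ℓ}` (`ℓ ≠ 2`, `ℓ ≥ 1`) then `1 + 3 ∑_{p ∣ w} p ≤ 10 ℓ`. [folklore] -/
private theorem one_add_three_mul_sum_le {w ℓ : ℕ} (hw : w.primeFactors ⊆ {2, ℓ}) (hℓ2 : ℓ ≠ 2)
    (hℓ1 : 1 ≤ ℓ) : (1 : ℝ) + 3 * ∑ p ∈ w.primeFactors, (p : ℝ) ≤ 10 * ℓ := by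
  have hsum : ∑ p ∈ w.primeFactors, (p : ℝ) ≤ ∑ p ∈ ({2, ℓ} : Finset ℕ), (p : ℝ) :=
    Finset.sum_le_sum_of_subset_of_nonneg hw fun p _ _ => Nat.cast_nonneg p
  rw [Finset.sum_pair (Ne.symm hℓ2)] at hsum
  have hℓ1' : (1 : ℝ) ≤ ℓ := by exact_mod_cast hℓ1
  push_cast at hsum
  linarith

/-! ## `Θ` at threshold `0`, and the self-improvement in the small-prime cell -/

/-- `Θ_{uv}` at threshold `0` is at most `K⁵ Λ⁴` when `uv` has `≤ 4` prime factors, all with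
`log p ≤ Λ` (`K, Λ ≥ 1`). [folklore] -/
private theorem theta_zero_le {K Λ : ℝ} (hK : 1 ≤ K) (hΛ : 1 ≤ Λ) {u v : ℕ} (hu : u ≠ 0)
    (hv : v ≠ 0) (huv : u.Coprime v) (hcard : (u * v).primeFactors.card ≤ 4)
    (hlog : ∀ p ∈ (u * v).primeFactors, Real.log p ≤ Λ) :
    theta K u v 0 ≤ K ^ 5 * Λ ^ 4 := by
  rw [theta_zero_eq K hu hv huv]
  have h1 : K ^ ((u * v).primeFactors.card + 1) ≤ K ^ 5 := pow_le_pow_right₀ hK (by omega)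
  have h0 : ∀ p ∈ (u * v).primeFactors, 0 ≤ Real.log (p : ℝ) := fun p hp =>
    Real.log_nonneg (by exact_mod_cast (Nat.prime_of_mem_primeFactors hp).one_lt.le)
  have h2 : ∏ p ∈ (u * v).primeFactors, Real.log (p : ℝ) ≤ Λ ^ 4 :=
    calc ∏ p ∈ (u * v).primeFactors, Real.log (p : ℝ) ≤ ∏ _p ∈ (u * v).primeFactors, Λ :=
          Finset.prod_le_prod h0 hlog
      _ = Λ ^ (u * v).primeFactors.card := Finset.prod_const Λ
      _ ≤ Λ ^ 4 := pow_le_pow_right₀ hΛ hcard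
  have hK0 : 0 < K := by linarith
  exact mul_le_mul h1 h2 (Finset.prod_nonneg h0) (by positivity)

/-- **Self-improvement in the small-prime cell** (pure analysis). If `y < Θ · log max{e, 2y} · F`
with `Θ ≤ K⁵ Λ⁴`, `0 ≤ F ≤ 10 X`, `X ≥ 1`, `log X ≤ ε Λ` and `K, Λ ≥ 1`, then
`y ≤ 20 K⁵ (log(40 K⁵) + 4 + ε) · X · Λ⁵`. [folklore] -/
private theorem le_of_lt_theta_mul {K ε Λ X y Θ F : ℝ} (hK : 1 ≤ K) (hΛ : 1 ≤ Λ) (hX : 1 ≤ X)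
    (hXΛ : Real.log X ≤ ε * Λ) (hΘ : Θ ≤ K ^ 5 * Λ ^ 4) (hF0 : 0 ≤ F) (hF : F ≤ 10 * X)
    (h : y < Θ * Real.log (max (Real.exp 1) (2 * y)) * F) :
    y ≤ 20 * K ^ 5 * (Real.log (40 * K ^ 5) + 4 + ε) * X * Λ ^ 5 := by
  set Y := Real.log (max (Real.exp 1) (2 * y)) with hY
  set M : ℝ := 10 * K ^ 5 * Λ ^ 4 * X with hM
  have hK0 : 0 < K := by linarith
  have hΛ0 : 0 < Λ := by linarith
  have hX0 : 0 < X := by linarith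
  have hY1 : 1 ≤ Y := one_le_log_max_exp _
  have hK5 : 1 ≤ K ^ 5 := one_le_pow₀ hK
  have hM1 : 1 ≤ M :=
    one_le_mul_of_one_le_of_one_le (one_le_mul_of_one_le_of_one_le (by linarith) (one_le_pow₀ hΛ)) hX
  have h1 : y ≤ M * Y :=
    calc y ≤ Θ * Y * F := h.le
      _ ≤ (K ^ 5 * Λ ^ 4) * Y * (10 * X) :=
          mul_le_mul (mul_le_mul_of_nonneg_right hΘ (by linarith)) hF hF0 (by positivity)
      _ = M * Y := by rw [hM]; ring
  -- `log(4M) ≤ (log(40K⁵) + 4 + ε) Λ`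
  have hexp : Real.log (4 * M) = Real.log (40 * K ^ 5) + 4 * Real.log Λ + Real.log X := by
    rw [show 4 * M = (40 * K ^ 5) * (Λ ^ 4 * X) by rw [hM]; ring,
      Real.log_mul (by positivity) (by positivity), Real.log_mul (by positivity) hX0.ne',
      Real.log_pow]
    push_cast
    ring
  have hlogΛ : Real.log Λ ≤ Λ := Real.log_le_self hΛ0.le
  have hc0 : 0 ≤ Real.log (40 * K ^ 5) := Real.log_nonneg (by nlinarith)
  have hc0Λ : Real.log (40 * K ^ 5) ≤ Real.log (40 * K ^ 5) * Λ := le_mul_of_one_le_right hc0 hΛ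
  have hlog4M : Real.log (4 * M) ≤ (Real.log (40 * K ^ 5) + 4 + ε) * Λ := by
    rw [hexp]; nlinarith
  have hM0 : 0 ≤ M := zero_le_one.trans hM1
  calc y ≤ 2 * M * Real.log (4 * M) := le_of_le_mul_log_max hM1 h1
    _ ≤ 2 * M * ((Real.log (40 * K ^ 5) + 4 + ε) * Λ) :=
        mul_le_mul_of_nonneg_left hlog4M (by positivity)
    _ = 20 * K ^ 5 * (Real.log (40 * K ^ 5) + 4 + ε) * X * Λ ^ 5 := by rw [hM]; ring

/-! ## From `log c` to the valuation product (glue adapted from the planner skeleton) -/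

/-- `v_p(n) · log 2 ≤ log n` for `p ∣ n ≠ 0` (`p^{v_p(n)} ≤ n`, `p ≥ 2`). [folklore] -/
private theorem factorization_mul_log_two_le {n p : ℕ} (hn : n ≠ 0) (hp : p ∈ n.primeFactors) :
    ((n.factorization p : ℕ) : ℝ) * Real.log 2 ≤ Real.log n := by
  -- adapted from Lines/matveev_face_clearing.lean (`factorization_le_log`)
  have hpp : p.Prime := Nat.prime_of_mem_primeFactors hp
  have h2p : (2 : ℝ) ≤ p := by exact_mod_cast hpp.two_le
  have hle : (p : ℝ) ^ n.factorization p ≤ n := by exact_mod_cast Nat.ordProj_le p hn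
  have hlog := Real.log_le_log (pow_pos (by linarith) _) hle
  rw [Real.log_pow] at hlog
  exact (mul_le_mul_of_nonneg_left (Real.log_le_log two_pos h2p) (Nat.cast_nonneg _)).trans hlog

/-- With `ω(n) ≤ 4`, `log n ≤ 3T` and `T ≥ 1`: `∏_{p ∣ n} v_p(n) ≤ (3T / log 2)⁴`. [folklore] -/
private theorem prod_factorization_le {n : ℕ} (hn : n ≠ 0) (hcard : n.primeFactors.card ≤ 4)
    {T : ℝ} (hT : 1 ≤ T) (hlog : Real.log n ≤ 3 * T) :
    ((∏ p ∈ n.primeFactors, n.factorization p : ℕ) : ℝ) ≤ (3 * T / Real.log 2) ^ 4 := by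
  -- adapted from Lines/matveev_face_clearing.lean (`prod_factorization_le`)
  rw [Nat.cast_prod]
  have hlog2 : 0 < Real.log 2 := Real.log_pos one_lt_two
  have hlog2' : Real.log 2 < 1 := by have := Real.log_two_lt_d9; linarith
  have h1 : 1 ≤ 3 * T / Real.log 2 := by rw [le_div_iff₀ hlog2]; linarith
  calc ∏ p ∈ n.primeFactors, ((n.factorization p : ℕ) : ℝ)
      ≤ ∏ _p ∈ n.primeFactors, (3 * T / Real.log 2) := by
        refine Finset.prod_le_prod (fun p _ => Nat.cast_nonneg _) fun p hp => ?_
        rw [le_div_iff₀ hlog2]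
        exact (factorization_mul_log_two_le hn hp).trans hlog
    _ = (3 * T / Real.log 2) ^ n.primeFactors.card := Finset.prod_const _
    _ ≤ (3 * T / Real.log 2) ^ 4 := pow_le_pow_right₀ h1 hcard

/-- Polylog versus power: for `m : ℕ`, `ε > 0` there is `D ≥ 0` with `max(log R, 1)^m ≤ D · R^ε`
for all `R ≥ 1` (`log R ≤ R^δ/δ`, `δ = min(1, ε/(m+1))`). [folklore] -/
private theorem polylog_le_rpow (m : ℕ) {ε : ℝ} (hε : 0 < ε) :
    ∃ D : ℝ, 0 ≤ D ∧ ∀ R : ℝ, 1 ≤ R → (max (Real.log R) 1) ^ m ≤ D * R ^ ε := by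
  -- adapted from Lines/matveev_face_clearing.lean (`polylog_le_rpow`)
  set δ : ℝ := min 1 (ε / (m + 1)) with hδ
  have hm1 : (0 : ℝ) < m + 1 := by positivity
  have hδpos : 0 < δ := lt_min one_pos (div_pos hε hm1)
  have hδ1 : δ ≤ 1 := min_le_left _ _
  have hδm : δ * m ≤ ε := by
    calc δ * m ≤ (ε / (m + 1)) * m :=
          mul_le_mul_of_nonneg_right (min_le_right _ _) (Nat.cast_nonneg m)
      _ ≤ (ε / (m + 1)) * (m + 1) :=
          mul_le_mul_of_nonneg_left (by linarith) (div_pos hε hm1).le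
      _ = ε := div_mul_cancel₀ ε hm1.ne'
  refine ⟨δ⁻¹ ^ m, pow_nonneg (inv_nonneg.mpr hδpos.le) m, fun R hR => ?_⟩
  have hR0 : 0 ≤ R := zero_le_one.trans hR
  have hRδ : 1 ≤ R ^ δ := Real.one_le_rpow hR hδpos.le
  have hkey : max (Real.log R) 1 ≤ R ^ δ / δ := by
    apply max_le
    · exact Real.log_le_rpow_div hR0 hδpos
    · rw [le_div_iff₀ hδpos, one_mul]
      exact hδ1.trans hRδ
  have h0 : 0 ≤ max (Real.log R) 1 := zero_le_one.trans (le_max_right _ _)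
  calc (max (Real.log R) 1) ^ m ≤ (R ^ δ / δ) ^ m := pow_le_pow_left₀ h0 hkey m
    _ = δ⁻¹ ^ m * (R ^ δ) ^ m := by rw [div_eq_mul_inv, mul_pow, mul_comm]
    _ = δ⁻¹ ^ m * R ^ (δ * m) := by rw [← Real.rpow_natCast (R ^ δ) m, ← Real.rpow_mul hR0]
    _ ≤ δ⁻¹ ^ m * R ^ ε := by
        apply mul_le_mul_of_nonneg_left _ (pow_nonneg (inv_nonneg.mpr hδpos.le) m)
        exact Real.rpow_le_rpow_of_exponent_le hR hδm

/-- **From `log c ≤ C₁ · rad^ε · Λ⁵` to the valuation product** (`Λ = max(log rad, 1)`, `ω(abc) ≤ 4`,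
`C₁ ≥ 1`, `Λ²⁰ ≤ D · rad^ε`): `∏_{p ∣ abc} v_p(abc) ≤ (3C₁/log 2)⁴ · D · rad^{5ε}`. [folklore] -/
private theorem prod_le_of_log_le {a b c : ℕ} (h : IsABCTriple a b c)
    (hcard : (a * b * c).primeFactors.card ≤ 4) {C₁ D ε : ℝ} (hε : 0 ≤ ε) (hC₁ : 1 ≤ C₁)
    (hD : ∀ R : ℝ, 1 ≤ R → (max (Real.log R) 1) ^ 20 ≤ D * R ^ ε)
    (hlog : Real.log c ≤ C₁ * (rad a b c : ℝ) ^ ε * (max (Real.log (rad a b c : ℝ)) 1) ^ 5) :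
    ((∏ p ∈ (a * b * c).primeFactors, (a * b * c).factorization p : ℕ) : ℝ) ≤
      (3 * C₁ / Real.log 2) ^ 4 * D * (rad a b c : ℝ) ^ (5 * ε) := by
  have hrad2 : 2 ≤ rad a b c := h.two_le_rad
  obtain ⟨ha, hb, hsum, hcop⟩ := h
  have hc : 0 < c := by omega
  have hn0 : a * b * c ≠ 0 := by positivity
  -- adapted from Lines/matveev_face_clearing.lean (`abc_le_cube`)
  have hcube : a * b * c ≤ c ^ 3 :=
    calc a * b * c ≤ c * c * c := by gcongr <;> omega
      _ = c ^ 3 := by ring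
  have hR1 : (1 : ℝ) ≤ (rad a b c : ℝ) := by exact_mod_cast le_trans (by norm_num) hrad2
  set R : ℝ := (rad a b c : ℝ) with hR
  set Λ : ℝ := max (Real.log R) 1 with hΛ
  have hR0 : 0 < R := by linarith
  have hX1 : 1 ≤ R ^ ε := Real.one_le_rpow hR1 hε
  have hT1 : 1 ≤ C₁ * R ^ ε * Λ ^ 5 :=
    one_le_mul_of_one_le_of_one_le (one_le_mul_of_one_le_of_one_le hC₁ hX1)
      (one_le_pow₀ (le_max_right _ _))
  have hlogn : Real.log (a * b * c : ℕ) ≤ 3 * (C₁ * R ^ ε * Λ ^ 5) := by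
    have h1 : ((a * b * c : ℕ) : ℝ) ≤ (c : ℝ) ^ 3 := by exact_mod_cast hcube
    have h2 := Real.log_le_log (by exact_mod_cast Nat.pos_of_ne_zero hn0) h1
    rw [Real.log_pow, Nat.cast_ofNat] at h2
    linarith
  have hX4 : (R ^ ε) ^ 4 * R ^ ε = R ^ (5 * ε) := by
    rw [← Real.rpow_mul_natCast hR0.le, ← Real.rpow_add hR0]
    congr 1
    push_cast
    ring
  have hX0 : 0 ≤ R ^ ε := zero_le_one.trans hX1
  have h0 : 0 ≤ (3 * C₁ / Real.log 2) ^ 4 * (R ^ ε) ^ 4 := by positivity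
  calc ((∏ p ∈ (a * b * c).primeFactors, (a * b * c).factorization p : ℕ) : ℝ)
      ≤ (3 * (C₁ * R ^ ε * Λ ^ 5) / Real.log 2) ^ 4 := prod_factorization_le hn0 hcard hT1 hlogn
    _ = (3 * C₁ / Real.log 2) ^ 4 * (R ^ ε) ^ 4 * Λ ^ 20 := by ring
    _ ≤ (3 * C₁ / Real.log 2) ^ 4 * (R ^ ε) ^ 4 * (D * R ^ ε) :=
        mul_le_mul_of_nonneg_left (hD R hR1) h0
    _ = (3 * C₁ / Real.log 2) ^ 4 * D * ((R ^ ε) ^ 4 * R ^ ε) := by ring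
    _ = (3 * C₁ / Real.log 2) ^ 4 * D * R ^ (5 * ε) := by rw [hX4]

/-! ## The route bound in the small-prime cell -/

/-- **One route, bounded.** If `log c < Θ_{uv} · Y · (1 + 3 ∑_{p ∣ w} p)` with `u, v` coprime non-zero,
`uv ∣ abc` (so `ω(uv) ≤ 4` and the primes of `uv` are `≤ rad`), and the primes of `w` lie in `{2, ℓ}`
with `ℓ ≤ rad^ε` odd, then `log c ≤ 20 K⁵ (log(40K⁵) + 4 + ε) · rad^ε · max(log rad, 1)⁵`. [folklore] -/
private theorem log_le_of_member {K ε : ℝ} (hK : 1 ≤ K) (hε : 0 < ε) {a b c u v w ℓ : ℕ}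
    (h : IsABCTriple a b c) (hcard : (a * b * c).primeFactors.card ≤ 4)
    (hu : u ≠ 0) (hv : v ≠ 0) (huv : u.Coprime v) (huvd : u * v ∣ a * b * c)
    (hw : w.primeFactors ⊆ {2, ℓ}) (hℓ2 : ℓ ≠ 2) (hℓ1 : 1 ≤ ℓ)
    (hℓR : (ℓ : ℝ) ≤ (rad a b c : ℝ) ^ ε)
    (hroute : Real.log c < theta K u v 0 * Real.log (max (Real.exp 1) (2 * Real.log c)) *
      (1 + 3 * ∑ p ∈ w.primeFactors, (p : ℝ))) :
    Real.log c ≤ 20 * K ^ 5 * (Real.log (40 * K ^ 5) + 4 + ε) * (rad a b c : ℝ) ^ ε *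
      (max (Real.log (rad a b c : ℝ)) 1) ^ 5 := by
  have hrad2 : 2 ≤ rad a b c := h.two_le_rad
  obtain ⟨ha, hb, habc, hcop⟩ := h
  have hc : c ≠ 0 := by omega
  have habc0 : a * b * c ≠ 0 := by positivity
  have hR1 : (1 : ℝ) ≤ (rad a b c : ℝ) := by exact_mod_cast le_trans (by norm_num) hrad2
  have hpR : ∀ p ∈ (u * v).primeFactors, (p : ℝ) ≤ (rad a b c : ℝ) := fun p hp => by
    exact_mod_cast prime_le_rad (Nat.prime_of_mem_primeFactors hp)
      ((Nat.dvd_of_mem_primeFactors hp).trans huvd) habc0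
  set R : ℝ := (rad a b c : ℝ) with hR
  set Λ : ℝ := max (Real.log R) 1 with hΛ
  have hR0 : 0 < R := by linarith
  have hΛ1 : 1 ≤ Λ := le_max_right _ _
  -- `ω(uv) ≤ 4` and `log p ≤ Λ` for `p ∣ uv`
  have hcard' : (u * v).primeFactors.card ≤ 4 :=
    (Finset.card_le_card (Nat.primeFactors_mono huvd habc0)).trans hcard
  have hlog : ∀ p ∈ (u * v).primeFactors, Real.log p ≤ Λ := fun p hp =>
    (Real.log_le_log (by exact_mod_cast (Nat.prime_of_mem_primeFactors hp).pos) (hpR p hp)).trans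
      (le_max_left _ _)
  have hΘ : theta K u v 0 ≤ K ^ 5 * Λ ^ 4 := theta_zero_le hK hΛ1 hu hv huv hcard' hlog
  have hF : (1 : ℝ) + 3 * ∑ p ∈ w.primeFactors, (p : ℝ) ≤ 10 * ℓ :=
    one_add_three_mul_sum_le hw hℓ2 hℓ1
  have hF0 : (0 : ℝ) ≤ 1 + 3 * ∑ p ∈ w.primeFactors, (p : ℝ) := by positivity
  have hX1 : 1 ≤ R ^ ε := Real.one_le_rpow hR1 hε.le
  have hXΛ : Real.log (R ^ ε) ≤ ε * Λ := by
    rw [Real.log_rpow hR0]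
    exact mul_le_mul_of_nonneg_left (le_max_left _ _) hε.le
  exact le_of_lt_theta_mul hK hΛ1 hX1 hXΛ hΘ hF0 (hF.trans (by linarith)) hroute

/-- **`log c ≤ C₁(K, ε) · rad^ε · max(log rad, 1)⁵` in the small-prime cell**: route through the member
containing the small odd prime (`log_lt_route_a/_b/_c`; the route through `c` needs `ab > 1`, true
since `a ≥ 2` off the faces). [folklore] -/
private theorem log_le_cell {K ε : ℝ} (hK : 1 ≤ K) (hP : PastenApproximationBound K) (hε : 0 < ε)
    {a b c : ℕ} (h : IsABCTriple a b c) (hcard : (a * b * c).primeFactors.card ≤ 4)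
    (hnf : ¬ ((∃ j : ℕ, a = 2 ^ j) ∨ (∃ j : ℕ, b = 2 ^ j) ∨ (∃ j : ℕ, c = 2 ^ j)))
    (hsmall : ∃ p ∈ (a * b * c).primeFactors, p ≠ 2 ∧ (p : ℝ) ≤ (rad a b c : ℝ) ^ ε) :
    Real.log c ≤ 20 * K ^ 5 * (Real.log (40 * K ^ 5) + 4 + ε) * (rad a b c : ℝ) ^ ε *
      (max (Real.log (rad a b c : ℝ)) 1) ^ 5 := by
  obtain ⟨ha, hb, habc, hcop⟩ := id h
  have hc : c ≠ 0 := by omega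
  have hbc : b.Coprime c := coprime_right_of_isABCTriple h
  have hac : a.Coprime c := coprime_left_of_isABCTriple h
  have hna : ¬ ∃ j : ℕ, a = 2 ^ j := fun h' => hnf (Or.inl h')
  have hnb : ¬ ∃ j : ℕ, b = 2 ^ j := fun h' => hnf (Or.inr (Or.inl h'))
  have hnc : ¬ ∃ j : ℕ, c = 2 ^ j := fun h' => hnf (Or.inr (Or.inr h'))
  have h2 : 2 ∣ a * b * c := two_dvd_abc h
  obtain ⟨ℓ, hℓ, hℓ2, hℓR⟩ := hsmall
  have hℓ1 : 1 ≤ ℓ := (Nat.prime_of_mem_primeFactors hℓ).one_lt.le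
  rw [Nat.primeFactors_mul (mul_ne_zero ha.ne' hb.ne') hc, Nat.primeFactors_mul ha.ne' hb.ne',
    Finset.mem_union, Finset.mem_union] at hℓ
  rcases hℓ with (hℓa | hℓb) | hℓc
  · -- `ℓ ∣ a`: route through `a` (archimedean place and the primes of `a`)
    have hw := primeFactors_subset_pair ha.ne' hb.ne' hc hcop hac hbc h2 hcard hnb hnc hℓa hℓ2
    exact log_le_of_member hK hε h hcard hb.ne' hc hbc (Dvd.intro_left a (mul_assoc a b c).symm)
      hw hℓ2 hℓ1 hℓR (log_lt_route_a hK hP h)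
  · -- `ℓ ∣ b`: route through `b`
    have h2' : 2 ∣ b * a * c := by rwa [mul_comm b a]
    have hcard' : (b * a * c).primeFactors.card ≤ 4 := by rwa [mul_comm b a]
    have hw :=
      primeFactors_subset_pair hb.ne' ha.ne' hc hcop.symm hbc hac h2' hcard' hna hnc hℓb hℓ2
    exact log_le_of_member hK hε h hcard ha.ne' hc hac (Dvd.intro b (by ring))
      hw hℓ2 hℓ1 hℓR (log_lt_route_b hK hP h)
  · -- `ℓ ∣ c`: route through `c` (needs `ab > 1`)
    have h2' : 2 ∣ c * a * b := by rw [show c * a * b = a * b * c by ring]; exact h2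
    have hcard' : (c * a * b).primeFactors.card ≤ 4 := by
      rw [show c * a * b = a * b * c by ring]; exact hcard
    have hw :=
      primeFactors_subset_pair hc ha.ne' hb.ne' hac.symm hbc.symm hcop h2' hcard' hna hnb hℓc hℓ2
    have ha2 : 2 ≤ a := by
      by_contra h'
      exact hna ⟨0, by rw [pow_zero]; omega⟩
    have h1 : 1 < a * b := lt_of_lt_of_le (by norm_num) (Nat.mul_le_mul ha2 hb)
    exact log_le_of_member hK hε h hcard ha.ne' hb.ne' hcop (Dvd.intro c rfl)
      hw hℓ2 hℓ1 hℓR (log_lt_route_c hK hP h h1)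

/-! ## The stub -/

/-- **Stub `stub_smallPrimeClearing` of line `matveev-face-clearing` — small-prime clearing in the
hard core.** If `PastenApproximationBound K` holds for some `K ≥ 1` (Matveev + Yu over `ℚ` in Pasten's
form, Pasten 2024 Thm 2.1), then for every `ε > 0` there is `C` such that every abc triple on `≤ 4`
primes, none of whose members is a power of two, which has an odd prime `p ∣ abc` with
`p ≤ rad(abc)^ε`, satisfies `∏_{p ∣ abc} v_p(abc) ≤ C · rad(abc)^{5ε}` (shape lemma, Stewart–Yu route
through the member of the small prime, `Θ ≤ K⁵Λ⁴`, self-improvement, `Λ²⁰ ≤ D(ε) rad^ε`). [folklore] -/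
theorem stub_smallPrimeClearing :
    (∃ K : ℝ, 1 ≤ K ∧ Literature.NumberTheory.DiophantineGeometry.Dioph.PastenApproximationBound K) →
    ∀ ε : ℝ, 0 < ε → ∃ C : ℝ, ∀ a b c : ℕ, Literature.NumberTheory.DiophantineGeometry.IsABCTriple a b c →
      (a * b * c).primeFactors.card ≤ 4 →
      ¬ ((∃ j : ℕ, a = 2 ^ j) ∨ (∃ j : ℕ, b = 2 ^ j) ∨ (∃ j : ℕ, c = 2 ^ j)) →
      (∃ p ∈ (a * b * c).primeFactors, p ≠ 2 ∧
        (p : ℝ) ≤ (Literature.NumberTheory.DiophantineGeometry.rad a b c : ℝ) ^ ε) →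
      ((∏ p ∈ (a * b * c).primeFactors, (a * b * c).factorization p : ℕ) : ℝ) ≤
        C * (Literature.NumberTheory.DiophantineGeometry.rad a b c : ℝ) ^ (5 * ε) := by
  rintro ⟨K, hK, hP⟩ ε hε
  obtain ⟨D, -, hD⟩ := polylog_le_rpow 20 hε
  set C₁ : ℝ := max (20 * K ^ 5 * (Real.log (40 * K ^ 5) + 4 + ε)) 1 with hC₁
  refine ⟨(3 * C₁ / Real.log 2) ^ 4 * D, fun a b c h hcard hnf hsmall => ?_⟩
  refine prod_le_of_log_le h hcard hε.le (le_max_right _ _) hD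
    ((log_le_cell hK hP hε h hcard hnf hsmall).trans ?_)
  have h0 : 0 ≤ (rad a b c : ℝ) ^ ε * (max (Real.log (rad a b c : ℝ)) 1) ^ 5 := by positivity
  calc 20 * K ^ 5 * (Real.log (40 * K ^ 5) + 4 + ε) * (rad a b c : ℝ) ^ ε *
        (max (Real.log (rad a b c : ℝ)) 1) ^ 5
      = 20 * K ^ 5 * (Real.log (40 * K ^ 5) + 4 + ε) *
          ((rad a b c : ℝ) ^ ε * (max (Real.log (rad a b c : ℝ)) 1) ^ 5) := by ring
    _ ≤ C₁ * ((rad a b c : ℝ) ^ ε * (max (Real.log (rad a b c : ℝ)) 1) ^ 5) :=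
        mul_le_mul_of_nonneg_right (le_max_left _ _) h0
    _ = C₁ * (rad a b c : ℝ) ^ ε * (max (Real.log (rad a b c : ℝ)) 1) ^ 5 := by ring

end Summit.ABC.ABC.Theorems.FewPrimeValuationProduct

end
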